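import Summits.QuantumFields.YangMills.Theses.PoincareLipschitz
import Summits.QuantumFields.YangMills.Theorems.PoincareLipschitzTwoSidedOfConcentrationStep
import Summits.QuantumFields.YangMills.Theorems.PoincareLipschitzTwoSidedOfConcentrationCounting
import Summits.QuantumFields.YangMills.Theorems.PoincareLipschitzTwoSidedOfConcentrationBudget
import Summits.QuantumFields.YangMills.Theorems.UnitScaleTiltHistoryTailBoundedHeightLocal
import HarnessLib

/-!
# LINE 27 «MedianCentring» (ideator ym-r3-idea-2 g15; registered on stmt-QuantumFields-23133 `RevelationMartingale.MeanDeviationShallowL`, crux of record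
# stmt-QuantumFields-19936 `UnitScaleTilt.HistoryTailL`) — STUB (M) `stub_meanOfMedian`: THE MEAN RECOVERED FROM THE 3∕4-QUANTILE AND THE LOCAL WINDOW TAIL

Cell `ym3-torus` (HUMAN RULING D-0037, YM ladder rung R3 — YM₃ on T³ is a rung, NOT d = 4, NOT infinite volume, NOT a mass gap, NOT Clay; the YM gap is NOT proved),
width seat `ym3-torus-px19` (gen 7; free-hands item per the ideator's «(T),(M) FREE-HANDS-READY» and ★★OWNER WORD 24 (3)).  THEOREMS ONLY (0 `def`, 0 `sorry`);
`--supports stmt-QuantumFields-23133`.  `stub_meanOfMedian` has EXACTLY the registered type of `Cruxes/HistoryTailL/Lines/median_centring.lean` (M) (c67fb96f, l.101).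

THE ARGUMENT (simpler than the card's plan: NO McShane extension and NO use of K1∕K2 inside (M) — the two crux hypotheses ride unused).  Fix a member, `0 < γ ≤ γ₁`,
a depth `1 ≤ j ≤ K − 2`, a level-`j` plaquette `a`; write `f := dist1(Ū^j(∂a)) ∈ [0, 2]`, `θ := θ(K−j) = g·p(g)`, `g = √(γL^{−(K−j)})`, and `G = G(a,j)` for the local good set
(all finer plaquettes in the `64L^j`-window are small).  POINTWISE `f ≤ θ∕8 + θ·𝟙{θ∕8 < f} + 2·𝟙{θ ≤ f}`, hence
`E f ≤ θ∕8 + θ·Gibbs{θ∕8 < f} + 2·Gibbs{θ ≤ f} ≤ θ∕8 + θ∕4 + 2·(Gibbs({θ ≤ f} ∩ G) + Gibbs(Gᶜ))`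
by the QUANTILE hypothesis (Q) (`Gibbs{f ≤ θ∕8} ≥ 3∕4`), the local window tail (T) (`Gibbs({θ ≤ f} ∩ G) ≤ C·e^{−c·p(g)²}`), and the LOCAL-GOOD BUDGET at precision `θ`:
`Gᶜ` is covered by the windowed bad events of the `≤ 9·129³·L^{3(j−i)}` near plaquettes of the finer levels (✓`compl_localGood_subset`, ✓`card_near_le_real` — the landed
minimal-failure cover of LINE 15), each bounded by (T) at depth `i ≥ 1` and by the tree's level-0 chessboard tail ✓`perPlaquette_boundedHeight_uniform L 0` at `i = 0`; the scalar
lemma `mean_budget` (§1; the ✓`localGood_budget` mechanism `e^{16x}·e^{−cx²} ≤ e^{−2x} = γL^{−h}` with the geometric level sum, sharpened from `≤ 1∕4` to `≤ θ∕16` using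
`Σ_h γL^{−h} ≤ 3γL^{−(K−j)} = 3g² ≤ 3√γ·g` and `p(g) ≥ b₀`) gives `(level sums) + C·e^{−c·p(g)²} ≤ θ∕16` for `γ ≤ γ_B(L, b₀, p₀, C₀, c₀, C, c)`.  Total: `E f ≤ 3θ∕8 + θ∕8 = θ∕2`.

WHAT IS PROVED (ns `…Theorems.PoincareLipschitz.MedianCentring`): §1 `mean_budget` (the scalar budget at precision `θ∕16`, over ✓`coupling_basic`∕`log_inv_coupling_ge`∕`pow_cube_le_exp`∕
`inv_coupling_sq_eq_exp`∕`sq_log_le_pFun_sq`∕`sum_Ico_inv_pow_le`); §2 `integral_le_of_quantile` (probability space, measurable `0 ≤ f ≤ 2`, `θ ≥ 0`, `μ{f ≤ θ∕8} ≥ 3∕4` ⟹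
`∫ f ≤ 3θ∕8 + 2·μ{θ ≤ f}`); §3 ★★★`stub_meanOfMedian` — the registered (M) text.  HONEST SCOPE: (Q) and (T) are HYPOTHESES here; the crux `MeanDeviationShallowL` closes only
with (Q) (open, XL) and (T) (px10 g6's pen); rung R3, not Clay; YM gap NOT proved.

References: T. Bałaban, CMP **102** (1985) 255–275 [Balaban1985UV3] ((3) p.256, (7) p.257, (71) p.273); M. Ledoux, *The concentration of measure phenomenon* (2001) [Ledoux2001] (Prop. 1.7–1.8).
-/

set_option autoImplicit false

namespace Summit.QuantumFields.YangMills.Theorems.PoincareLipschitz.MedianCentring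

open MeasureTheory
open scoped BigOperators
open Literature.MathematicalPhysics.QuantumFieldTheory.Balaban1983to89
open Literature.MathematicalPhysics.QuantumFieldTheory.Balaban1983to89.T3ContinuumYM3Torus
open Literature.MathematicalPhysics.QuantumFieldTheory.Balaban1983to89.T3UnitScaleTilt
open Literature.MathematicalPhysics.QuantumFieldTheory.Balaban1983to89.T3UnitLawDensityEML (ℰp measurableE_ℰp)
open Literature.MathematicalPhysics.QuantumFieldTheory.Balaban1983to89.T3MinimiserStabilityReduction (θBal_pos)
open Literature.MathematicalPhysics.QuantumFieldTheory.Balaban1983to89.T4PairDerivBridge (dist1_le_two_specialUnitaryGroup)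
open Summit.QuantumFields.YangMills.Theorems.HistoryTailBoundedHeightLocal (perPlaquette_boundedHeight_uniform)
open Summit.QuantumFields.YangMills.Theorems.PoincareLipschitz.TwoSidedOfConcentration
  (coupling_basic log_inv_coupling_ge pow_cube_le_exp inv_coupling_sq_eq_exp sq_log_le_pFun_sq sum_Ico_inv_pow_le
   compl_localGood_subset card_near_le_real)

/-! ## §1 The scalar budget at precision `θ∕16` -/

set_option maxHeartbeats 400000 in
-- hb: eight-term real bookkeeping (`gcongr`∕`ring_nf` over `Real.exp` products); measured > 100k (fails) and < 200k (passes) on the farm — decl-local headroom per README.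
/-- **THE LOCAL-GOOD BUDGET AND THE WINDOW TAIL AT PRECISION `θ(K−j)∕16`.**  For `L ≥ 2`, `b₀ > 0`, `p₀ ≥ 1`, `V, C₀, Ct ≥ 0`, `c₀, ct > 0` there is `γ_B ∈ (0,1]` such that
for all `0 < γ ≤ γ_B`, all `K` and `j ≤ K`:
`V·L^{3j}·C₀·β_K⁵·e^{−c₀p(g_K)²} + Σ_{1≤i<j} V·L^{3(j−i)}·Ct·e^{−ct·p(g_{K−i})²} + Ct·e^{−ct·p(g_{K−j})²} ≤ θ(K−j)∕16` (`θ(h) = g_h·p(g_h)`, `g_h = √(γL^{−h})`).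
Mechanism of ✓`localGood_budget` (each term `≤ const·γL^{−h}`, `x_h = log g_h⁻¹ ≥ 18∕c + 1`), then `Σ ≤ (VC₀ + 2VCt + Ct)·g_{K−j}²`, `g ≤ √γ`, `p(g) ≥ b₀`.  (The ideator's
`Cruxes/HistoryTailL/Lines/median_centring_budget.lean` carries the sibling pair `localGood_budget_theta` ∕ `windowTail_le_theta` with a free precision `M`; Cruxes modules are not importable
under `Theorems/`, and the stub proof wants the two in ONE displayed sum at `M = 16`, hence this lemma.) [folklore; cite: Balaban1985UV3, (7) p.257] -/
theorem mean_budget {L : ℕ} (hL : 2 ≤ L) {b₀ p₀ V C₀ c₀ Ct ct : ℝ} (hb₀ : 0 < b₀) (hp₀ : 1 ≤ p₀) (hV : 0 ≤ V)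
    (hC₀ : 0 ≤ C₀) (hc₀ : 0 < c₀) (hCt : 0 ≤ Ct) (hct : 0 < ct) :
    ∃ γB : ℝ, 0 < γB ∧ γB ≤ 1 ∧ ∀ γ : ℝ, 0 < γ → γ ≤ γB → ∀ K j : ℕ, j ≤ K →
      V * ((L : ℝ) ^ j) ^ 3 * (C₀ * ((γ * ((L : ℝ)⁻¹) ^ K)⁻¹) ^ 5 *
          Real.exp (-(c₀ * B10.pFun b₀ p₀ (Real.sqrt (γ * ((L : ℝ)⁻¹) ^ K)) ^ 2))) +
        ∑ i ∈ Finset.Ico 1 j, V * ((L : ℝ) ^ (j - i)) ^ 3 *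
          (Ct * Real.exp (-(ct * B10.pFun b₀ p₀ (Real.sqrt (γ * ((L : ℝ)⁻¹) ^ (K - i))) ^ 2))) +
        Ct * Real.exp (-(ct * B10.pFun b₀ p₀ (Real.sqrt (γ * ((L : ℝ)⁻¹) ^ (K - j))) ^ 2))
      ≤ θBal L γ b₀ p₀ (K - j) / 16 := by
  have hL1 : 1 ≤ L := by omega
  have hL' : (1 : ℝ) ≤ L := by exact_mod_cast hL1
  have hL2 : (2 : ℝ) ≤ L := by exact_mod_cast hL
  -- the quadratic rate
  set c : ℝ := min c₀ ct * b₀ ^ 2 with hc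
  have hcpos : 0 < c := mul_pos (lt_min hc₀ hct) (pow_pos hb₀ 2)
  set X : ℝ := 18 / c + 1 with hX
  have hX0 : 0 ≤ X := by positivity
  -- the threshold
  set D : ℝ := V * C₀ + 2 * (V * Ct) + Ct + 1 with hD
  have hD0 : 0 < D := by positivity
  refine ⟨min 1 (min (Real.exp (-(2 * X))) ((b₀ / (16 * D)) ^ 2)), by positivity,
    min_le_left _ _, fun γ hγ hγB K j hjK => ?_⟩
  have hγ1 : γ ≤ 1 := hγB.trans (min_le_left _ _)
  have hγX : γ ≤ Real.exp (-(2 * X)) := hγB.trans ((min_le_right _ _).trans (min_le_left _ _))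
  have hγD : γ ≤ (b₀ / (16 * D)) ^ 2 := hγB.trans ((min_le_right _ _).trans (min_le_right _ _))
  -- the key pointwise estimate at height `h`: polynomial prefactor `e^{A x}` (`A ≤ 16`) against `e^{-c x²}`
  have key : ∀ h : ℕ, ∀ A : ℝ, A ≤ 16 →
      Real.exp (A * Real.log (Real.sqrt (γ * ((L : ℝ)⁻¹) ^ h))⁻¹) *
          Real.exp (-(c * Real.log (Real.sqrt (γ * ((L : ℝ)⁻¹) ^ h))⁻¹ ^ 2)) ≤ γ * ((L : ℝ)⁻¹) ^ h := by
    intro h A hA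
    obtain ⟨hg, hg1, hg2, _⟩ := coupling_basic hL1 hγ hγ1 h
    have hx := log_inv_coupling_ge hL1 hγ hγ1 hγX h
    set x := Real.log (Real.sqrt (γ * ((L : ℝ)⁻¹) ^ h))⁻¹ with hxdef
    have hx0 : 0 ≤ x := hX0.trans hx
    have hquad : 18 * x ≤ c * x ^ 2 := by
      have h1 : 18 ≤ c * X := by
        rw [hX, mul_add, mul_div_cancel₀ _ hcpos.ne']
        linarith [hcpos]
      have h2 : c * X ≤ c * x := mul_le_mul_of_nonneg_left hx hcpos.le
      nlinarith
    rw [← Real.exp_add, ← hg2, B10.sq_eq_exp_log _ hg, ← hxdef]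
    exact Real.exp_le_exp.mpr (by nlinarith)
  -- `p(g_h)² ≥ b₀² x_h²`, hence `e^{-c' p²} ≤ e^{-c x²}` for `c' ≥ min c₀ ct`
  have hrate : ∀ h : ℕ, ∀ c' : ℝ, min c₀ ct ≤ c' →
      Real.exp (-(c' * B10.pFun b₀ p₀ (Real.sqrt (γ * ((L : ℝ)⁻¹) ^ h)) ^ 2)) ≤
        Real.exp (-(c * Real.log (Real.sqrt (γ * ((L : ℝ)⁻¹) ^ h))⁻¹ ^ 2)) := by
    intro h c' hc'
    obtain ⟨hg, hg1, _, _⟩ := coupling_basic hL1 hγ hγ1 h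
    have hp := sq_log_le_pFun_sq (b₀ := b₀) hp₀ hg hg1
    have hmin0 : 0 ≤ min c₀ ct := (lt_min hc₀ hct).le
    refine Real.exp_le_exp.mpr (neg_le_neg ?_)
    calc c * Real.log (Real.sqrt (γ * ((L : ℝ)⁻¹) ^ h))⁻¹ ^ 2
        = min c₀ ct * (b₀ ^ 2 * Real.log (Real.sqrt (γ * ((L : ℝ)⁻¹) ^ h))⁻¹ ^ 2) := by rw [hc]; ring
      _ ≤ min c₀ ct * B10.pFun b₀ p₀ (Real.sqrt (γ * ((L : ℝ)⁻¹) ^ h)) ^ 2 := mul_le_mul_of_nonneg_left hp hmin0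
      _ ≤ c' * B10.pFun b₀ p₀ (Real.sqrt (γ * ((L : ℝ)⁻¹) ^ h)) ^ 2 := mul_le_mul_of_nonneg_right hc' (sq_nonneg _)
  -- the three families of terms, each `≤ const · γ L^{-h}`
  have hT0 : V * ((L : ℝ) ^ j) ^ 3 * (C₀ * ((γ * ((L : ℝ)⁻¹) ^ K)⁻¹) ^ 5 *
      Real.exp (-(c₀ * B10.pFun b₀ p₀ (Real.sqrt (γ * ((L : ℝ)⁻¹) ^ K)) ^ 2))) ≤ V * C₀ * (γ * ((L : ℝ)⁻¹) ^ K) := by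
    set x := Real.log (Real.sqrt (γ * ((L : ℝ)⁻¹) ^ K))⁻¹ with hxdef
    have hLj : ((L : ℝ) ^ j) ^ 3 ≤ ((L : ℝ) ^ K) ^ 3 :=
      pow_le_pow_left₀ (by positivity) (pow_le_pow_right₀ hL' hjK) 3
    have hLK : ((L : ℝ) ^ K) ^ 3 ≤ Real.exp (6 * x) := pow_cube_le_exp hL1 hγ hγ1 K
    have hβ : ((γ * ((L : ℝ)⁻¹) ^ K)⁻¹) ^ 5 = Real.exp (10 * x) := by
      rw [inv_coupling_sq_eq_exp hL1 hγ hγ1 K, ← hxdef, ← Real.exp_nat_mul]; ring_nf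
    have hE := hrate K c₀ (min_le_left _ _)
    have hk := key K 16 le_rfl
    have hL3 : ((L : ℝ) ^ j) ^ 3 ≤ Real.exp (6 * x) := hLj.trans hLK
    calc V * ((L : ℝ) ^ j) ^ 3 * (C₀ * ((γ * ((L : ℝ)⁻¹) ^ K)⁻¹) ^ 5 *
          Real.exp (-(c₀ * B10.pFun b₀ p₀ (Real.sqrt (γ * ((L : ℝ)⁻¹) ^ K)) ^ 2)))
        ≤ V * Real.exp (6 * x) * (C₀ * Real.exp (10 * x) * Real.exp (-(c * x ^ 2))) := by
          rw [hβ]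
          gcongr
      _ = V * C₀ * (Real.exp (16 * x) * Real.exp (-(c * x ^ 2))) := by
          have : Real.exp (16 * x) = Real.exp (6 * x) * Real.exp (10 * x) := by rw [← Real.exp_add]; ring_nf
          rw [this]; ring
      _ ≤ V * C₀ * (γ * ((L : ℝ)⁻¹) ^ K) := by gcongr
  have hTi : ∀ i ∈ Finset.Ico 1 j, V * ((L : ℝ) ^ (j - i)) ^ 3 *
      (Ct * Real.exp (-(ct * B10.pFun b₀ p₀ (Real.sqrt (γ * ((L : ℝ)⁻¹) ^ (K - i))) ^ 2))) ≤
        V * Ct * (γ * ((L : ℝ)⁻¹) ^ (K - i)) := by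
    intro i hi
    rw [Finset.mem_Ico] at hi
    set x := Real.log (Real.sqrt (γ * ((L : ℝ)⁻¹) ^ (K - i)))⁻¹ with hxdef
    have hLj : ((L : ℝ) ^ (j - i)) ^ 3 ≤ ((L : ℝ) ^ (K - i)) ^ 3 :=
      pow_le_pow_left₀ (by positivity) (pow_le_pow_right₀ hL' (by omega)) 3
    have hLK : ((L : ℝ) ^ (K - i)) ^ 3 ≤ Real.exp (6 * x) := pow_cube_le_exp hL1 hγ hγ1 (K - i)
    have hE := hrate (K - i) ct (min_le_right _ _)
    have hk := key (K - i) 6 (by norm_num)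
    have hL3 : ((L : ℝ) ^ (j - i)) ^ 3 ≤ Real.exp (6 * x) := hLj.trans hLK
    calc V * ((L : ℝ) ^ (j - i)) ^ 3 * (Ct * Real.exp (-(ct * B10.pFun b₀ p₀ (Real.sqrt (γ * ((L : ℝ)⁻¹) ^ (K - i))) ^ 2)))
        ≤ V * Real.exp (6 * x) * (Ct * Real.exp (-(c * x ^ 2))) := by
          gcongr
      _ = V * Ct * (Real.exp (6 * x) * Real.exp (-(c * x ^ 2))) := by ring
      _ ≤ V * Ct * (γ * ((L : ℝ)⁻¹) ^ (K - i)) := by gcongr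
  have hTtop : Ct * Real.exp (-(ct * B10.pFun b₀ p₀ (Real.sqrt (γ * ((L : ℝ)⁻¹) ^ (K - j))) ^ 2)) ≤ Ct * (γ * ((L : ℝ)⁻¹) ^ (K - j)) := by
    set x := Real.log (Real.sqrt (γ * ((L : ℝ)⁻¹) ^ (K - j)))⁻¹ with hxdef
    have hE := hrate (K - j) ct (min_le_right _ _)
    have hk := key (K - j) 0 (by norm_num)
    rw [zero_mul, Real.exp_zero, one_mul] at hk
    exact mul_le_mul_of_nonneg_left (hE.trans hk) hCt
  -- the geometric level sum, and the comparison of the heights `K`, `K − i` with `K − j`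
  have hr0 : 0 ≤ (L : ℝ)⁻¹ := inv_nonneg.mpr (by linarith)
  have hr1 : (L : ℝ)⁻¹ ≤ 1 / 2 := by rw [one_div]; exact inv_anti₀ two_pos hL2
  have hgeo : ∑ i ∈ Finset.Ico 1 j, ((L : ℝ)⁻¹) ^ (K - i) ≤ 2 * ((L : ℝ)⁻¹) ^ (K - j) := by
    have h1r : (1 : ℝ) / 2 ≤ 1 - (L : ℝ)⁻¹ := by linarith
    have hs := sum_Ico_inv_pow_le hL K j hjK
    have hp : ((L : ℝ)⁻¹) ^ (K - j + 1) ≤ ((L : ℝ)⁻¹) ^ (K - j) := by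
      rw [pow_succ]; exact mul_le_of_le_one_right (pow_nonneg hr0 _) (by linarith)
    calc ∑ i ∈ Finset.Ico 1 j, ((L : ℝ)⁻¹) ^ (K - i) ≤ ((L : ℝ)⁻¹) ^ (K - j + 1) / (1 - (L : ℝ)⁻¹) := hs
      _ ≤ ((L : ℝ)⁻¹) ^ (K - j) / (1 / 2) := by
          exact div_le_div₀ (pow_nonneg hr0 _) hp (by norm_num) h1r
      _ = 2 * ((L : ℝ)⁻¹) ^ (K - j) := by ring
  have hKj : ((L : ℝ)⁻¹) ^ K ≤ ((L : ℝ)⁻¹) ^ (K - j) := pow_le_pow_of_le_one hr0 (by linarith) (Nat.sub_le K j)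
  -- the coupling at height `K − j`
  obtain ⟨hg, hg1, hg2, hgγ⟩ := coupling_basic hL1 hγ hγ1 (K - j)
  set g := Real.sqrt (γ * ((L : ℝ)⁻¹) ^ (K - j)) with hgdef
  have hgsqrt : g ≤ Real.sqrt γ := by rw [hgdef]; exact Real.sqrt_le_sqrt hgγ
  have hsγ : Real.sqrt γ ≤ b₀ / (16 * D) := by
    rw [← Real.sqrt_sq (by positivity : (0 : ℝ) ≤ b₀ / (16 * D))]
    exact Real.sqrt_le_sqrt hγD
  have hgD : D * g ≤ b₀ / 16 := by
    have h1 : D * g ≤ D * (b₀ / (16 * D)) := mul_le_mul_of_nonneg_left (hgsqrt.trans hsγ) hD0.le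
    have h2 : D * (b₀ / (16 * D)) = b₀ / 16 := by field_simp
    linarith
  -- `p(g) ≥ b₀`, so `θ = g·p(g) ≥ b₀ g`
  have hpg : b₀ ≤ B10.pFun b₀ p₀ g := by
    unfold B10.pFun
    have hx : 0 ≤ Real.log g⁻¹ := B10.log_inv_nonneg_of_le_one hg hg1
    have h1 : (1 : ℝ) ≤ (1 + Real.log g⁻¹) ^ p₀ := Real.one_le_rpow (by linarith) (by linarith)
    exact le_mul_of_one_le_right hb₀.le h1
  have hθ : b₀ * g ≤ θBal L γ b₀ p₀ (K - j) := by
    rw [θBal, ← hgdef, mul_comm b₀ g]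
    exact mul_le_mul_of_nonneg_left hpg hg.le
  -- sum up
  have hsum : ∑ i ∈ Finset.Ico 1 j, V * ((L : ℝ) ^ (j - i)) ^ 3 *
      (Ct * Real.exp (-(ct * B10.pFun b₀ p₀ (Real.sqrt (γ * ((L : ℝ)⁻¹) ^ (K - i))) ^ 2))) ≤ 2 * (V * Ct) * (γ * ((L : ℝ)⁻¹) ^ (K - j)) := by
    calc ∑ i ∈ Finset.Ico 1 j, V * ((L : ℝ) ^ (j - i)) ^ 3 *
          (Ct * Real.exp (-(ct * B10.pFun b₀ p₀ (Real.sqrt (γ * ((L : ℝ)⁻¹) ^ (K - i))) ^ 2)))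
        ≤ ∑ i ∈ Finset.Ico 1 j, V * Ct * (γ * ((L : ℝ)⁻¹) ^ (K - i)) := Finset.sum_le_sum hTi
      _ = V * Ct * γ * ∑ i ∈ Finset.Ico 1 j, ((L : ℝ)⁻¹) ^ (K - i) := by rw [Finset.mul_sum]; ring_nf
      _ ≤ V * Ct * γ * (2 * ((L : ℝ)⁻¹) ^ (K - j)) := by gcongr
      _ = 2 * (V * Ct) * (γ * ((L : ℝ)⁻¹) ^ (K - j)) := by ring
  have h0' : V * C₀ * (γ * ((L : ℝ)⁻¹) ^ K) ≤ V * C₀ * (γ * ((L : ℝ)⁻¹) ^ (K - j)) :=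
    mul_le_mul_of_nonneg_left (mul_le_mul_of_nonneg_left hKj hγ.le) (by positivity)
  have htot : V * C₀ * (γ * ((L : ℝ)⁻¹) ^ (K - j)) + 2 * (V * Ct) * (γ * ((L : ℝ)⁻¹) ^ (K - j)) + Ct * (γ * ((L : ℝ)⁻¹) ^ (K - j))
      ≤ D * g * g := by
    rw [← hg2]
    have : V * C₀ * g ^ 2 + 2 * (V * Ct) * g ^ 2 + Ct * g ^ 2 = (V * C₀ + 2 * (V * Ct) + Ct) * g * g := by ring
    rw [this]
    have hle : V * C₀ + 2 * (V * Ct) + Ct ≤ D := by rw [hD]; linarith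
    exact mul_le_mul_of_nonneg_right (mul_le_mul_of_nonneg_right hle hg.le) hg.le
  have hfin : D * g * g ≤ θBal L γ b₀ p₀ (K - j) / 16 := by
    calc D * g * g ≤ b₀ / 16 * g := mul_le_mul_of_nonneg_right hgD hg.le
      _ = b₀ * g / 16 := by ring
      _ ≤ θBal L γ b₀ p₀ (K - j) / 16 := by linarith [hθ]
  calc V * ((L : ℝ) ^ j) ^ 3 * (C₀ * ((γ * ((L : ℝ)⁻¹) ^ K)⁻¹) ^ 5 *
          Real.exp (-(c₀ * B10.pFun b₀ p₀ (Real.sqrt (γ * ((L : ℝ)⁻¹) ^ K)) ^ 2))) +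
        ∑ i ∈ Finset.Ico 1 j, V * ((L : ℝ) ^ (j - i)) ^ 3 *
          (Ct * Real.exp (-(ct * B10.pFun b₀ p₀ (Real.sqrt (γ * ((L : ℝ)⁻¹) ^ (K - i))) ^ 2))) +
        Ct * Real.exp (-(ct * B10.pFun b₀ p₀ (Real.sqrt (γ * ((L : ℝ)⁻¹) ^ (K - j))) ^ 2))
      ≤ V * C₀ * (γ * ((L : ℝ)⁻¹) ^ K) + 2 * (V * Ct) * (γ * ((L : ℝ)⁻¹) ^ (K - j)) + Ct * (γ * ((L : ℝ)⁻¹) ^ (K - j)) :=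
        add_le_add (add_le_add hT0 hsum) hTtop
    _ ≤ V * C₀ * (γ * ((L : ℝ)⁻¹) ^ (K - j)) + 2 * (V * Ct) * (γ * ((L : ℝ)⁻¹) ^ (K - j)) + Ct * (γ * ((L : ℝ)⁻¹) ^ (K - j)) :=
        add_le_add (add_le_add h0' le_rfl) le_rfl
    _ ≤ D * g * g := htot
    _ ≤ θBal L γ b₀ p₀ (K - j) / 16 := hfin

/-! ## §2 The mean from a quantile and a tail -/

/-- **MEAN FROM A 3∕4-QUANTILE AND A TAIL**: on a probability space, for a measurable `f` with `0 ≤ f ≤ 2`, `θ ≥ 0` and `μ{f ≤ θ∕8} ≥ 3∕4`: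
`∫ f ≤ 3θ∕8 + 2·μ{θ ≤ f}` — pointwise `f ≤ θ∕8 + θ·𝟙{θ∕8 < f} + 2·𝟙{θ ≤ f}`. [cite: Ledoux2001, Prop. 1.7] -/
theorem integral_le_of_quantile {X : Type*} [MeasurableSpace X] (μ : Measure X) [IsProbabilityMeasure μ]
    {f : X → ℝ} (hf : Measurable f) (hf0 : ∀ x, 0 ≤ f x) (hf2 : ∀ x, f x ≤ 2) {θ : ℝ} (hθ : 0 ≤ θ)
    (hq : 3 / 4 ≤ μ.real {x | f x ≤ θ / 8}) :
    ∫ x, f x ∂μ ≤ 3 * θ / 8 + 2 * μ.real {x | θ ≤ f x} := by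
  have hA : MeasurableSet {x | θ / 8 < f x} := measurableSet_lt measurable_const hf
  have hB : MeasurableSet {x | θ ≤ f x} := measurableSet_le measurable_const hf
  have hQ : MeasurableSet {x | f x ≤ θ / 8} := measurableSet_le hf measurable_const
  have hf_int : Integrable f μ :=
    Integrable.mono' (integrable_const (2 : ℝ)) hf.aestronglyMeasurable
      (ae_of_all _ fun x => by rw [Real.norm_eq_abs, abs_of_nonneg (hf0 x)]; exact hf2 x)
  have hIA : Integrable ({x | θ / 8 < f x}.indicator fun _ => θ) μ := (integrable_const θ).indicator hA
  have hIB : Integrable ({x | θ ≤ f x}.indicator fun _ => (2 : ℝ)) μ := (integrable_const (2 : ℝ)).indicator hB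
  -- pointwise domination
  have hpt : ∀ x, f x ≤ θ / 8 + ({x | θ / 8 < f x}.indicator (fun _ => θ) x + {x | θ ≤ f x}.indicator (fun _ => (2 : ℝ)) x) := by
    intro x
    by_cases h1 : θ ≤ f x
    · rw [Set.indicator_of_mem (show x ∈ {x | θ ≤ f x} from h1)]
      have hnn : 0 ≤ {x | θ / 8 < f x}.indicator (fun _ => θ) x := Set.indicator_nonneg (fun _ _ => hθ) x
      linarith [hf2 x]
    · rw [Set.indicator_of_notMem (show x ∉ {x | θ ≤ f x} from h1)]
      by_cases h2 : θ / 8 < f x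
      · rw [Set.indicator_of_mem (show x ∈ {x | θ / 8 < f x} from h2)]
        linarith [not_le.mp h1]
      · rw [Set.indicator_of_notMem (show x ∉ {x | θ / 8 < f x} from h2)]
        linarith [not_lt.mp h2]
  -- integrate
  have e1 : ∫ x, (θ / 8 + ({x | θ / 8 < f x}.indicator (fun _ => θ) x + {x | θ ≤ f x}.indicator (fun _ => (2 : ℝ)) x)) ∂μ
      = ∫ _x, (θ / 8 : ℝ) ∂μ + ∫ x, ({x | θ / 8 < f x}.indicator (fun _ => θ) x + {x | θ ≤ f x}.indicator (fun _ => (2 : ℝ)) x) ∂μ :=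
    integral_add (integrable_const _) (hIA.add hIB)
  have e2 : ∫ x, ({x | θ / 8 < f x}.indicator (fun _ => θ) x + {x | θ ≤ f x}.indicator (fun _ => (2 : ℝ)) x) ∂μ
      = ∫ x, {x | θ / 8 < f x}.indicator (fun _ => θ) x ∂μ + ∫ x, {x | θ ≤ f x}.indicator (fun _ => (2 : ℝ)) x ∂μ :=
    integral_add hIA hIB
  have e3 : ∫ x, {x | θ / 8 < f x}.indicator (fun _ => θ) x ∂μ = μ.real {x | θ / 8 < f x} * θ := by
    rw [integral_indicator_const θ hA, smul_eq_mul]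
  have e4 : ∫ x, {x | θ ≤ f x}.indicator (fun _ => (2 : ℝ)) x ∂μ = μ.real {x | θ ≤ f x} * 2 := by
    rw [integral_indicator_const (2 : ℝ) hB, smul_eq_mul]
  have e0 : ∫ _x, (θ / 8 : ℝ) ∂μ = θ / 8 := by rw [integral_const, smul_eq_mul, probReal_univ, one_mul]
  have hint : ∫ x, f x ∂μ ≤ θ / 8 + (μ.real {x | θ / 8 < f x} * θ + μ.real {x | θ ≤ f x} * 2) := by
    have h : ∫ x, f x ∂μ ≤ ∫ x, (θ / 8 + ({x | θ / 8 < f x}.indicator (fun _ => θ) x + {x | θ ≤ f x}.indicator (fun _ => (2 : ℝ)) x)) ∂μ :=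
      integral_mono hf_int ((integrable_const _).add (hIA.add hIB)) hpt
    rw [e1, e2, e3, e4, e0] at h
    exact h
  -- the quantile: `μ{θ/8 < f} ≤ 1/4`
  have hcompl : μ.real {x | θ / 8 < f x} ≤ 1 / 4 := by
    have h1 : μ.real {x | f x ≤ θ / 8} + μ.real {x | f x ≤ θ / 8}ᶜ = 1 := by
      rw [measureReal_add_measureReal_compl hQ, probReal_univ]
    have h2 : {x | f x ≤ θ / 8}ᶜ = {x | θ / 8 < f x} := by ext x; simp [not_le]
    rw [h2] at h1
    linarith
  have hθμ : μ.real {x | θ / 8 < f x} * θ ≤ 1 / 4 * θ := mul_le_mul_of_nonneg_right hcompl hθ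
  linarith

/-! ## §3 ★★★ The registered stub (M) -/

set_option maxHeartbeats 400000 in
-- hb: the registered statement carries four displayed route texts (~40 lines) and the proof re-runs ✓`local_tail`'s 50-line budget `calc` over them; measured above the default in the scratch.
/-- ★★★ **(M) `stub_meanOfMedian` — THE MEAN RECOVERED** (the registered text of `Cruxes/HistoryTailL/Lines/median_centring.lean` :101 VERBATIM): from K1, K2 (unused), the 3∕4-quantile
bound (Q) and the local window tail (T): `E dist1(Ū^j(∂a)) ≤ θ(K−j)∕2` at all depths `1 ≤ j ≤ K − 2`, for `γ ≤ γ₁(L, b₀, p₀)`.  Proof: §2 with the quantile (Q); the tail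
`Gibbs{θ ≤ f} ≤ Gibbs({θ ≤ f} ∩ G(a,j)) + Gibbs(G(a,j)ᶜ)`; (T) for the first, ✓`compl_localGood_subset` + ✓`card_near_le_real` + (T) at the finer depths + ✓`perPlaquette_boundedHeight_uniform L 0`
for the second (✓`local_tail`'s cover, verbatim); §1 `mean_budget` makes `2·(…) ≤ θ∕8`. [cite: Balaban1985UV3, (7) p.257, (71) p.273; Ledoux2001, Prop. 1.7-1.8] -/
theorem stub_meanOfMedian :
    Summit.QuantumFields.YangMills.Theses.PoincareLipschitz.MesoscopicConcentrationL →
    Summit.QuantumFields.YangMills.Theses.PoincareLipschitz.BlockLipschitzL →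
    (∀ (L : ℕ) (b₀ p₀ : ℝ), 0 < b₀ → 2 < p₀ → ∃ γ₁ : ℝ, 0 < γ₁ ∧ γ₁ ≤ 1 ∧ ∀ (F : T3Family) (γ : ℝ), F.L = L → 0 < γ → γ ≤ γ₁ →
            ∀ (K j : ℕ), 1 ≤ j → j + 2 ≤ K → ∀ a : Plaq (F.P K) j,
              3 / 4 ≤ (gibbsK F ℰp γ K).real {U : GaugeField (F.P K) 0 (Matrix.specialUnitaryGroup (Fin 2) ℂ) | GaugeGroup.dist1 (GaugeField.plaqHol (Averaging.iter (fun i' => BlockAveraging.blockAvg (P := F.P K) (j := i') ℰp) j U) a) ≤ θBal F.L γ b₀ p₀ (K - j) / 8}) →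
    (∀ (L : ℕ) (b₀ p₀ : ℝ), 0 < b₀ → 2 < p₀ → ∃ (γ₁ C c : ℝ), 0 < γ₁ ∧ γ₁ ≤ 1 ∧ 0 ≤ C ∧ 0 < c ∧ ∀ (F : T3Family) (γ : ℝ), F.L = L → 0 < γ → γ ≤ γ₁ →
            ∀ (K j : ℕ), 1 ≤ j → j + 2 ≤ K → ∀ a : Plaq (F.P K) j,
              (gibbsK F ℰp γ K).real ({U : GaugeField (F.P K) 0 (Matrix.specialUnitaryGroup (Fin 2) ℂ) | θBal F.L γ b₀ p₀ (K - j) ≤ GaugeGroup.dist1 (GaugeField.plaqHol (Averaging.iter (fun i' => BlockAveraging.blockAvg (P := F.P K) (j := i') ℰp) j U) a)} ∩ {U : GaugeField (F.P K) 0 (Matrix.specialUnitaryGroup (Fin 2) ℂ) | (∀ (i : ℕ) (q : Plaq (F.P K) i), i < j → Site.tdist (fun k => ((((q.src k).val * F.L ^ i : ℕ)) : ZMod ((F.P K).sitesPerDir 0))) (fun k => ((((a.src k).val * F.L ^ j : ℕ)) : ZMod ((F.P K).sitesPerDir 0))) + 64 * F.L ^ i ≤ 64 * F.L ^ j → GaugeGroup.dist1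 (GaugeField.plaqHol (Averaging.iter (fun i' => BlockAveraging.blockAvg (P := F.P K) (j := i') ℰp) i U) q) < θBal F.L γ b₀ p₀ (K - i))}) ≤
                C * Real.exp (-(c * B10.pFun b₀ p₀ (Real.sqrt (γ * ((F.L : ℝ)⁻¹) ^ (K - j))) ^ 2))) →
    ∀ (L : ℕ) (b₀ p₀ : ℝ), 0 < b₀ → 2 < p₀ → ∃ γ₁ : ℝ, 0 < γ₁ ∧ γ₁ ≤ 1 ∧ ∀ (F : T3Family) (γ : ℝ), F.L = L → 0 < γ → γ ≤ γ₁ →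
          ∀ (K j : ℕ), 1 ≤ j → j + 2 ≤ K → ∀ a : Plaq (F.P K) j,
            ∫ U, GaugeGroup.dist1 (GaugeField.plaqHol (Averaging.iter (fun i' => BlockAveraging.blockAvg (P := F.P K) (j := i') ℰp) j U) a) ∂(gibbsK F ℰp γ K) ≤ θBal F.L γ b₀ p₀ (K - j) / 2 := by
  intro _hC _hLip hQ hT L b₀ p₀ hb₀ hp₀
  obtain ⟨γQ, hγQ, hγQ1, HQ⟩ := hQ L b₀ p₀ hb₀ hp₀
  obtain ⟨γT, Ct, ct, hγT, hγT1, hCt, hct, HT⟩ := hT L b₀ p₀ hb₀ hp₀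
  obtain ⟨C₀, c₀, hC₀, hc₀, H0⟩ := perPlaquette_boundedHeight_uniform L 0
  -- degenerate block size: no family has `F.L = L < 2`
  by_cases hL : 2 ≤ L
  swap
  · refine ⟨1, one_pos, le_rfl, fun F γ hFL => ?_⟩
    exact absurd (hFL ▸ F.hL.2) (by omega)
  obtain ⟨γB, hγB, hγB1, HB⟩ := mean_budget hL hb₀ (by linarith : (1 : ℝ) ≤ p₀)
    (by norm_num : (0 : ℝ) ≤ 9 * 129 ^ 3) hC₀ hc₀ hCt hct
  refine ⟨min γQ (min γT (min γB (1 / 2))), by positivity, (min_le_left _ _).trans hγQ1, fun F γ hFL hγ hγle K j hj hjK a => ?_⟩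
  have hγQ' : γ ≤ γQ := hγle.trans (min_le_left _ _)
  have hγT' : γ ≤ γT := hγle.trans ((min_le_right _ _).trans (min_le_left _ _))
  have hγB' : γ ≤ γB := hγle.trans ((min_le_right _ _).trans ((min_le_right _ _).trans (min_le_left _ _)))
  have hγ2 : γ ≤ 1 / 2 := hγle.trans ((min_le_right _ _).trans ((min_le_right _ _).trans (min_le_right _ _)))
  have hγ1 : γ ≤ 1 := by linarith
  subst hFL
  haveI := isProbabilityMeasure_gibbsK F ℰp hγ.le K
  have hL1 : 1 ≤ F.L := F.hL.2.le
  have hβ : (F.scheme ℰp γ).β K = (γ * ((F.L : ℝ)⁻¹) ^ K)⁻¹ := rfl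
  have hθpos : 0 < θBal F.L γ b₀ p₀ (K - j) := θBal_pos hL1 hγ hγ1 hb₀ p₀ (K - j)
  -- measurability and boundedness of the block-plaquette deviation
  have hmeas : Measurable fun U : GaugeField (F.P K) 0 (Matrix.specialUnitaryGroup (Fin 2) ℂ) => GaugeGroup.dist1 (GaugeField.plaqHol (Averaging.iter (fun i' => BlockAveraging.blockAvg (P := F.P K) (j := i') ℰp) j U) a) :=
    RegularGaugeGroup.measurable_dist1.comp ((Missing.measurable_plaqHol a).comp
      (T4Continuum.measurable_iter _ (F.avgMeasurable_of_measurableE ℰp measurableE_ℰp K) j))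
  -- the complement of the local good set: ✓`local_tail`'s cover, with (T) in place of the induction hypothesis
  have hGc : (gibbsK F ℰp γ K).real {U : GaugeField (F.P K) 0 (Matrix.specialUnitaryGroup (Fin 2) ℂ) | (∀ (i : ℕ) (q : Plaq (F.P K) i), i < j → Site.tdist (fun k => ((((q.src k).val * F.L ^ i : ℕ)) : ZMod ((F.P K).sitesPerDir 0))) (fun k => ((((a.src k).val * F.L ^ j : ℕ)) : ZMod ((F.P K).sitesPerDir 0))) + 64 * F.L ^ i ≤ 64 * F.L ^ j → GaugeGroup.dist1 (GaugeField.plaqHol (Averaging.iter (fun i' => BlockAveraging.blockAvg (P := F.P K) (j := i') ℰp) i U) q) < θBal F.L γ b₀ p₀ (K - i))}ᶜ ≤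
      9 * 129 ^ 3 * ((F.L : ℝ) ^ j) ^ 3 * (C₀ * ((γ * ((F.L : ℝ)⁻¹) ^ K)⁻¹) ^ 5 * Real.exp (-(c₀ * B10.pFun b₀ p₀ (Real.sqrt (γ * ((F.L : ℝ)⁻¹) ^ (K))) ^ 2))) +             ∑ i ∈ Finset.Ico 1 j, 9 * 129 ^ 3 * ((F.L : ℝ) ^ (j - i)) ^ 3 * (Ct * Real.exp (-(ct * B10.pFun b₀ p₀ (Real.sqrt (γ * ((F.L : ℝ)⁻¹) ^ (K - i))) ^ 2))) := by
    have hcov := compl_localGood_subset F (X := GaugeField (F.P K) 0 (Matrix.specialUnitaryGroup (Fin 2) ℂ)) K j a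
      (fun i q U => GaugeGroup.dist1 (GaugeField.plaqHol (Averaging.iter (fun i' => BlockAveraging.blockAvg (P := F.P K) (j := i') ℰp) i U) q)) (fun i => θBal F.L γ b₀ p₀ (K - i))
    beta_reduce at hcov
    -- level 0: the tree's volume-uniform finest-level tail
    have h0 : ∀ q : Plaq (F.P K) 0, (gibbsK F ℰp γ K).real ({U : GaugeField (F.P K) 0 (Matrix.specialUnitaryGroup (Fin 2) ℂ) | θBal F.L γ b₀ p₀ (K - 0) ≤ GaugeGroup.dist1 (GaugeField.plaqHol (Averaging.iter (fun i' => BlockAveraging.blockAvg (P := F.P K) (j := i') ℰp) 0 U) q)} ∩ {U : GaugeField (F.P K) 0 (Matrix.specialUnitaryGroup (Fin 2) ℂ) | (∀ (i' : ℕ) (q' : Plaq (F.P K) i'), i' < 0 → Site.tdist (fun k => ((((q'.src k).val * F.L ^ i' : ℕ)) : ZMod ((F.P K).sitesPerDir 0))) (fun k => ((((q.src k).val * F.L ^ 0 : ℕ)) : ZMod ((F.P K).sitesPerDir 0))) + 64 * F.L ^ i' ≤ 64 * F.L ^ 0 → GaugeGroup.dist1 (GaugeField.plaqHol (Averaging.iter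 (fun i' => BlockAveraging.blockAvg (P := F.P K) (j := i') ℰp) i' U) q') < θBal F.L γ b₀ p₀ (K - i'))}) ≤
        C₀ * ((γ * ((F.L : ℝ)⁻¹) ^ K)⁻¹) ^ 5 * Real.exp (-(c₀ * B10.pFun b₀ p₀ (Real.sqrt (γ * ((F.L : ℝ)⁻¹) ^ (K))) ^ 2)) := by
      intro q
      have h := H0 F rfl γ hγ hγ1 b₀ hb₀.le p₀ K 0 (Nat.zero_le K) le_rfl q
      simp only [Nat.sub_zero] at h
      rw [hβ] at h
      exact (measureReal_mono Set.inter_subset_left (measure_ne_top _ _)).trans h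
    -- levels `1 ≤ i < j`: the induction hypothesis
    have hi : ∀ i ∈ Finset.Ico 1 j, ∀ q : Plaq (F.P K) i, (gibbsK F ℰp γ K).real ({U : GaugeField (F.P K) 0 (Matrix.specialUnitaryGroup (Fin 2) ℂ) | θBal F.L γ b₀ p₀ (K - i) ≤ GaugeGroup.dist1 (GaugeField.plaqHol (Averaging.iter (fun i' => BlockAveraging.blockAvg (P := F.P K) (j := i') ℰp) i U) q)} ∩ {U : GaugeField (F.P K) 0 (Matrix.specialUnitaryGroup (Fin 2) ℂ) | (∀ (i' : ℕ) (q' : Plaq (F.P K) i'), i' < i → Site.tdist (fun k => ((((q'.src k).val * F.L ^ i' : ℕ)) : ZMod ((F.P K).sitesPerDir 0))) (fun k => ((((q.src k).val * F.L ^ i : ℕ)) : ZMod ((F.P K).sitesPerDir 0))) + 64 * F.L ^ i' ≤ 64 * F.L ^ i → GaugeGroup.dist1 (GaugeField.plaqHol (Averaging.iter (fun i' => BlockAveraging.blockAvg (P := F.P K) (j := i') ℰp) i' U) q') < θBal F.L γ b₀ p₀ (K - i'))}) ≤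
        Ct * Real.exp (-(ct * B10.pFun b₀ p₀ (Real.sqrt (γ * ((F.L : ℝ)⁻¹) ^ (K - i))) ^ 2)) := by
      intro i hi q
      rw [Finset.mem_Ico] at hi
      exact HT F γ rfl hγ hγT' K i hi.1 (by omega) q
    -- the counts
    have hN : ∀ i, i ≤ j → (((Finset.univ.filter fun q : Plaq (F.P K) i => Site.tdist (fun k => ((((q.src k).val * F.L ^ i : ℕ)) : ZMod ((F.P K).sitesPerDir 0))) (fun k => ((((a.src k).val * F.L ^ j : ℕ)) : ZMod ((F.P K).sitesPerDir 0))) + 64 * F.L ^ i ≤ 64 * F.L ^ j)).card : ℝ) ≤ 9 * 129 ^ 3 * ((F.L : ℝ) ^ (j - i)) ^ 3 :=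
      fun i hij => card_near_le_real F hij (by omega) a
    calc (gibbsK F ℰp γ K).real {U : GaugeField (F.P K) 0 (Matrix.specialUnitaryGroup (Fin 2) ℂ) | (∀ (i : ℕ) (q : Plaq (F.P K) i), i < j → Site.tdist (fun k => ((((q.src k).val * F.L ^ i : ℕ)) : ZMod ((F.P K).sitesPerDir 0))) (fun k => ((((a.src k).val * F.L ^ j : ℕ)) : ZMod ((F.P K).sitesPerDir 0))) + 64 * F.L ^ i ≤ 64 * F.L ^ j → GaugeGroup.dist1 (GaugeField.plaqHol (Averaging.iter (fun i' => BlockAveraging.blockAvg (P := F.P K) (j := i') ℰp) i U) q) < θBal F.L γ b₀ p₀ (K - i))}ᶜ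
        ≤ (gibbsK F ℰp γ K).real (⋃ i ∈ Finset.range j, ⋃ q ∈ (Finset.univ.filter fun q : Plaq (F.P K) i => Site.tdist (fun k => ((((q.src k).val * F.L ^ i : ℕ)) : ZMod ((F.P K).sitesPerDir 0))) (fun k => ((((a.src k).val * F.L ^ j : ℕ)) : ZMod ((F.P K).sitesPerDir 0))) + 64 * F.L ^ i ≤ 64 * F.L ^ j), ({U : GaugeField (F.P K) 0 (Matrix.specialUnitaryGroup (Fin 2) ℂ) | θBal F.L γ b₀ p₀ (K - i) ≤ GaugeGroup.dist1 (GaugeField.plaqHol (Averaging.iter (fun i' => BlockAveraging.blockAvg (P := F.P K) (j := i') ℰp) i U) q)} ∩ {U : GaugeField (F.P K) 0 (Matrix.specialUnitaryGroup (Fin 2) ℂ) | (∀ (i' : ℕ) (q' : Plaq (F.P K) i'), i' < i → Site.tdist (fun k => ((((q'.src k).val * F.L ^ i' : ℕ)) : ZMod ((F.P K).sitesPerDir 0))) (fun k => ((((q.src k).val * F.L ^ i : ℕ)) : ZMod ((F.P K).sitesPerDir 0))) + 64 * F.L ^ i' ≤ 64 * F.L ^ i → GaugeGroup.dist1 (GaugeField.plaqHol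 (Averaging.iter (fun i' => BlockAveraging.blockAvg (P := F.P K) (j := i') ℰp) i' U) q') < θBal F.L γ b₀ p₀ (K - i'))})) :=
          measureReal_mono hcov (measure_ne_top _ _)
      _ ≤ ∑ i ∈ Finset.range j, (gibbsK F ℰp γ K).real (⋃ q ∈ (Finset.univ.filter fun q : Plaq (F.P K) i => Site.tdist (fun k => ((((q.src k).val * F.L ^ i : ℕ)) : ZMod ((F.P K).sitesPerDir 0))) (fun k => ((((a.src k).val * F.L ^ j : ℕ)) : ZMod ((F.P K).sitesPerDir 0))) + 64 * F.L ^ i ≤ 64 * F.L ^ j), ({U : GaugeField (F.P K) 0 (Matrix.specialUnitaryGroup (Fin 2) ℂ) | θBal F.L γ b₀ p₀ (K - i) ≤ GaugeGroup.dist1 (GaugeField.plaqHol (Averaging.iter (fun i' => BlockAveraging.blockAvg (P := F.P K) (j := i') ℰp) i U) q)} ∩ {U : GaugeField (F.P K) 0 (Matrix.specialUnitaryGroup (Fin 2) ℂ) | (∀ (i' : ℕ) (q' : Plaq (F.P K) i'), i' < i → Site.tdist (fun k => ((((q'.src k).val * F.L ^ i' : ℕ)) : ZMod ((F.P K).sitesPerDir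 0))) (fun k => ((((q.src k).val * F.L ^ i : ℕ)) : ZMod ((F.P K).sitesPerDir 0))) + 64 * F.L ^ i' ≤ 64 * F.L ^ i → GaugeGroup.dist1 (GaugeField.plaqHol (Averaging.iter (fun i' => BlockAveraging.blockAvg (P := F.P K) (j := i') ℰp) i' U) q') < θBal F.L γ b₀ p₀ (K - i'))})) :=
          measureReal_biUnion_finset_le _ _
      _ ≤ ∑ i ∈ Finset.range j, ∑ q ∈ (Finset.univ.filter fun q : Plaq (F.P K) i => Site.tdist (fun k => ((((q.src k).val * F.L ^ i : ℕ)) : ZMod ((F.P K).sitesPerDir 0))) (fun k => ((((a.src k).val * F.L ^ j : ℕ)) : ZMod ((F.P K).sitesPerDir 0))) + 64 * F.L ^ i ≤ 64 * F.L ^ j), (gibbsK F ℰp γ K).real ({U : GaugeField (F.P K) 0 (Matrix.specialUnitaryGroup (Fin 2) ℂ) | θBal F.L γ b₀ p₀ (K - i) ≤ GaugeGroup.dist1 (GaugeField.plaqHol (Averaging.iter (fun i' => BlockAveraging.blockAvg (P := F.P K) (j := i') ℰp) i U) q)} ∩ {U : GaugeField (F.P K) 0 (Matrix.specialUnitaryGroup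 (Fin 2) ℂ) | (∀ (i' : ℕ) (q' : Plaq (F.P K) i'), i' < i → Site.tdist (fun k => ((((q'.src k).val * F.L ^ i' : ℕ)) : ZMod ((F.P K).sitesPerDir 0))) (fun k => ((((q.src k).val * F.L ^ i : ℕ)) : ZMod ((F.P K).sitesPerDir 0))) + 64 * F.L ^ i' ≤ 64 * F.L ^ i → GaugeGroup.dist1 (GaugeField.plaqHol (Averaging.iter (fun i' => BlockAveraging.blockAvg (P := F.P K) (j := i') ℰp) i' U) q') < θBal F.L γ b₀ p₀ (K - i'))}) :=
          Finset.sum_le_sum fun i _ => measureReal_biUnion_finset_le _ _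
      _ = ∑ q ∈ (Finset.univ.filter fun q : Plaq (F.P K) 0 => Site.tdist (fun k => ((((q.src k).val * F.L ^ 0 : ℕ)) : ZMod ((F.P K).sitesPerDir 0))) (fun k => ((((a.src k).val * F.L ^ j : ℕ)) : ZMod ((F.P K).sitesPerDir 0))) + 64 * F.L ^ 0 ≤ 64 * F.L ^ j), (gibbsK F ℰp γ K).real ({U : GaugeField (F.P K) 0 (Matrix.specialUnitaryGroup (Fin 2) ℂ) | θBal F.L γ b₀ p₀ (K - 0) ≤ GaugeGroup.dist1 (GaugeField.plaqHol (Averaging.iter (fun i' => BlockAveraging.blockAvg (P := F.P K) (j := i') ℰp) 0 U) q)} ∩ {U : GaugeField (F.P K) 0 (Matrix.specialUnitaryGroup (Fin 2) ℂ) | (∀ (i' : ℕ) (q' : Plaq (F.P K) i'), i' < 0 → Site.tdist (fun k => ((((q'.src k).val * F.L ^ i' : ℕ)) : ZMod ((F.P K).sitesPerDir 0))) (fun k => ((((q.src k).val * F.L ^ 0 : ℕ)) : ZMod ((F.P K).sitesPerDir 0))) + 64 * F.L ^ i' ≤ 64 * F.L ^ 0 → GaugeGroup.dist1 (GaugeField.plaqHol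 (Averaging.iter (fun i' => BlockAveraging.blockAvg (P := F.P K) (j := i') ℰp) i' U) q') < θBal F.L γ b₀ p₀ (K - i'))}) +
            ∑ i ∈ Finset.Ico 1 j, ∑ q ∈ (Finset.univ.filter fun q : Plaq (F.P K) i => Site.tdist (fun k => ((((q.src k).val * F.L ^ i : ℕ)) : ZMod ((F.P K).sitesPerDir 0))) (fun k => ((((a.src k).val * F.L ^ j : ℕ)) : ZMod ((F.P K).sitesPerDir 0))) + 64 * F.L ^ i ≤ 64 * F.L ^ j), (gibbsK F ℰp γ K).real ({U : GaugeField (F.P K) 0 (Matrix.specialUnitaryGroup (Fin 2) ℂ) | θBal F.L γ b₀ p₀ (K - i) ≤ GaugeGroup.dist1 (GaugeField.plaqHol (Averaging.iter (fun i' => BlockAveraging.blockAvg (P := F.P K) (j := i') ℰp) i U) q)} ∩ {U : GaugeField (F.P K) 0 (Matrix.specialUnitaryGroup (Fin 2) ℂ) | (∀ (i' : ℕ) (q' : Plaq (F.P K) i'), i' < i → Site.tdist (fun k => ((((q'.src k).val * F.L ^ i' : ℕ)) : ZMod ((F.P K).sitesPerDir 0))) (fun k => ((((q.src k).val * F.L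 ^ i : ℕ)) : ZMod ((F.P K).sitesPerDir 0))) + 64 * F.L ^ i' ≤ 64 * F.L ^ i → GaugeGroup.dist1 (GaugeField.plaqHol (Averaging.iter (fun i' => BlockAveraging.blockAvg (P := F.P K) (j := i') ℰp) i' U) q') < θBal F.L γ b₀ p₀ (K - i'))}) := by
          rw [Finset.range_eq_Ico, Finset.sum_eq_sum_Ico_succ_bot hj]
      _ ≤ 9 * 129 ^ 3 * ((F.L : ℝ) ^ j) ^ 3 * (C₀ * ((γ * ((F.L : ℝ)⁻¹) ^ K)⁻¹) ^ 5 * Real.exp (-(c₀ * B10.pFun b₀ p₀ (Real.sqrt (γ * ((F.L : ℝ)⁻¹) ^ (K))) ^ 2))) +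
            ∑ i ∈ Finset.Ico 1 j, 9 * 129 ^ 3 * ((F.L : ℝ) ^ (j - i)) ^ 3 * (Ct * Real.exp (-(ct * B10.pFun b₀ p₀ (Real.sqrt (γ * ((F.L : ℝ)⁻¹) ^ (K - i))) ^ 2))) := by
          refine add_le_add ?_ (Finset.sum_le_sum fun i hi' => ?_)
          · calc ∑ q ∈ (Finset.univ.filter fun q : Plaq (F.P K) 0 => Site.tdist (fun k => ((((q.src k).val * F.L ^ 0 : ℕ)) : ZMod ((F.P K).sitesPerDir 0))) (fun k => ((((a.src k).val * F.L ^ j : ℕ)) : ZMod ((F.P K).sitesPerDir 0))) + 64 * F.L ^ 0 ≤ 64 * F.L ^ j), (gibbsK F ℰp γ K).real ({U : GaugeField (F.P K) 0 (Matrix.specialUnitaryGroup (Fin 2) ℂ) | θBal F.L γ b₀ p₀ (K - 0) ≤ GaugeGroup.dist1 (GaugeField.plaqHol (Averaging.iter (fun i' => BlockAveraging.blockAvg (P := F.P K) (j := i') ℰp) 0 U) q)} ∩ {U : GaugeField (F.P K) 0 (Matrix.specialUnitaryGroup (Fin 2) ℂ) | (∀ (i' : ℕ) (q' : Plaq (F.P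 K) i'), i' < 0 → Site.tdist (fun k => ((((q'.src k).val * F.L ^ i' : ℕ)) : ZMod ((F.P K).sitesPerDir 0))) (fun k => ((((q.src k).val * F.L ^ 0 : ℕ)) : ZMod ((F.P K).sitesPerDir 0))) + 64 * F.L ^ i' ≤ 64 * F.L ^ 0 → GaugeGroup.dist1 (GaugeField.plaqHol (Averaging.iter (fun i' => BlockAveraging.blockAvg (P := F.P K) (j := i') ℰp) i' U) q') < θBal F.L γ b₀ p₀ (K - i'))})
                ≤ ∑ q ∈ (Finset.univ.filter fun q : Plaq (F.P K) 0 => Site.tdist (fun k => ((((q.src k).val * F.L ^ 0 : ℕ)) : ZMod ((F.P K).sitesPerDir 0))) (fun k => ((((a.src k).val * F.L ^ j : ℕ)) : ZMod ((F.P K).sitesPerDir 0))) + 64 * F.L ^ 0 ≤ 64 * F.L ^ j), C₀ * ((γ * ((F.L : ℝ)⁻¹) ^ K)⁻¹) ^ 5 * Real.exp (-(c₀ * B10.pFun b₀ p₀ (Real.sqrt (γ * ((F.L : ℝ)⁻¹) ^ (K))) ^ 2)) :=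
                  Finset.sum_le_sum fun q _ => h0 q
              _ = ((Finset.univ.filter fun q : Plaq (F.P K) 0 => Site.tdist (fun k => ((((q.src k).val * F.L ^ 0 : ℕ)) : ZMod ((F.P K).sitesPerDir 0))) (fun k => ((((a.src k).val * F.L ^ j : ℕ)) : ZMod ((F.P K).sitesPerDir 0))) + 64 * F.L ^ 0 ≤ 64 * F.L ^ j)).card * (C₀ * ((γ * ((F.L : ℝ)⁻¹) ^ K)⁻¹) ^ 5 * Real.exp (-(c₀ * B10.pFun b₀ p₀ (Real.sqrt (γ * ((F.L : ℝ)⁻¹) ^ (K))) ^ 2))) := by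
                  rw [Finset.sum_const, nsmul_eq_mul]
              _ ≤ 9 * 129 ^ 3 * ((F.L : ℝ) ^ j) ^ 3 * (C₀ * ((γ * ((F.L : ℝ)⁻¹) ^ K)⁻¹) ^ 5 * Real.exp (-(c₀ * B10.pFun b₀ p₀ (Real.sqrt (γ * ((F.L : ℝ)⁻¹) ^ (K))) ^ 2))) := by
                  have h := hN 0 (Nat.zero_le j)
                  rw [Nat.sub_zero] at h
                  exact mul_le_mul_of_nonneg_right h (by positivity)
          · calc ∑ q ∈ (Finset.univ.filter fun q : Plaq (F.P K) i => Site.tdist (fun k => ((((q.src k).val * F.L ^ i : ℕ)) : ZMod ((F.P K).sitesPerDir 0))) (fun k => ((((a.src k).val * F.L ^ j : ℕ)) : ZMod ((F.P K).sitesPerDir 0))) + 64 * F.L ^ i ≤ 64 * F.L ^ j), (gibbsK F ℰp γ K).real ({U : GaugeField (F.P K) 0 (Matrix.specialUnitaryGroup (Fin 2) ℂ) | θBal F.L γ b₀ p₀ (K - i) ≤ GaugeGroup.dist1 (GaugeField.plaqHol (Averaging.iter (fun i' => BlockAveraging.blockAvg (P := F.P K) (j := i') ℰp) i U) q)} ∩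 {U : GaugeField (F.P K) 0 (Matrix.specialUnitaryGroup (Fin 2) ℂ) | (∀ (i' : ℕ) (q' : Plaq (F.P K) i'), i' < i → Site.tdist (fun k => ((((q'.src k).val * F.L ^ i' : ℕ)) : ZMod ((F.P K).sitesPerDir 0))) (fun k => ((((q.src k).val * F.L ^ i : ℕ)) : ZMod ((F.P K).sitesPerDir 0))) + 64 * F.L ^ i' ≤ 64 * F.L ^ i → GaugeGroup.dist1 (GaugeField.plaqHol (Averaging.iter (fun i' => BlockAveraging.blockAvg (P := F.P K) (j := i') ℰp) i' U) q') < θBal F.L γ b₀ p₀ (K - i'))})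
                ≤ ∑ q ∈ (Finset.univ.filter fun q : Plaq (F.P K) i => Site.tdist (fun k => ((((q.src k).val * F.L ^ i : ℕ)) : ZMod ((F.P K).sitesPerDir 0))) (fun k => ((((a.src k).val * F.L ^ j : ℕ)) : ZMod ((F.P K).sitesPerDir 0))) + 64 * F.L ^ i ≤ 64 * F.L ^ j), Ct * Real.exp (-(ct * B10.pFun b₀ p₀ (Real.sqrt (γ * ((F.L : ℝ)⁻¹) ^ (K - i))) ^ 2)) :=
                  Finset.sum_le_sum fun q _ => hi i hi' q
              _ = ((Finset.univ.filter fun q : Plaq (F.P K) i => Site.tdist (fun k => ((((q.src k).val * F.L ^ i : ℕ)) : ZMod ((F.P K).sitesPerDir 0))) (fun k => ((((a.src k).val * F.L ^ j : ℕ)) : ZMod ((F.P K).sitesPerDir 0))) + 64 * F.L ^ i ≤ 64 * F.L ^ j)).card * (Ct * Real.exp (-(ct * B10.pFun b₀ p₀ (Real.sqrt (γ * ((F.L : ℝ)⁻¹) ^ (K - i))) ^ 2))) := by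
                  rw [Finset.sum_const, nsmul_eq_mul]
              _ ≤ 9 * 129 ^ 3 * ((F.L : ℝ) ^ (j - i)) ^ 3 * (Ct * Real.exp (-(ct * B10.pFun b₀ p₀ (Real.sqrt (γ * ((F.L : ℝ)⁻¹) ^ (K - i))) ^ 2))) :=
                  mul_le_mul_of_nonneg_right (hN i (Finset.mem_Ico.mp hi').2.le) (by positivity)
  -- the budget at precision `θ/16`: the cover sum plus the window tail
  have hbud := HB γ hγ hγB' K j (by omega)
  have htail := HT F γ rfl hγ hγT' K j hj hjK a
  -- the full tail `Gibbs{θ ≤ f} ≤ Gibbs({θ ≤ f} ∩ G) + Gibbs(Gᶜ)`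
  have hsplit : (gibbsK F ℰp γ K).real {U : GaugeField (F.P K) 0 (Matrix.specialUnitaryGroup (Fin 2) ℂ) | θBal F.L γ b₀ p₀ (K - j) ≤ GaugeGroup.dist1 (GaugeField.plaqHol (Averaging.iter (fun i' => BlockAveraging.blockAvg (P := F.P K) (j := i') ℰp) j U) a)}
      ≤ (gibbsK F ℰp γ K).real ({U : GaugeField (F.P K) 0 (Matrix.specialUnitaryGroup (Fin 2) ℂ) | θBal F.L γ b₀ p₀ (K - j) ≤ GaugeGroup.dist1 (GaugeField.plaqHol (Averaging.iter (fun i' => BlockAveraging.blockAvg (P := F.P K) (j := i') ℰp) j U) a)} ∩ {U : GaugeField (F.P K) 0 (Matrix.specialUnitaryGroup (Fin 2) ℂ) | (∀ (i : ℕ) (q : Plaq (F.P K) i), i < j → Site.tdist (fun k => ((((q.src k).val * F.L ^ i : ℕ)) : ZMod ((F.P K).sitesPerDir 0))) (fun k => ((((a.src k).val * F.L ^ j : ℕ)) : ZMod ((F.P K).sitesPerDir 0))) + 64 * F.L ^ i ≤ 64 * F.L ^ j → GaugeGroup.dist1 (GaugeField.plaqHol (Averaging.iter (fun i' => BlockAveraging.blockAvg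 (P := F.P K) (j := i') ℰp) i U) q) < θBal F.L γ b₀ p₀ (K - i))})
        + (gibbsK F ℰp γ K).real {U : GaugeField (F.P K) 0 (Matrix.specialUnitaryGroup (Fin 2) ℂ) | (∀ (i : ℕ) (q : Plaq (F.P K) i), i < j → Site.tdist (fun k => ((((q.src k).val * F.L ^ i : ℕ)) : ZMod ((F.P K).sitesPerDir 0))) (fun k => ((((a.src k).val * F.L ^ j : ℕ)) : ZMod ((F.P K).sitesPerDir 0))) + 64 * F.L ^ i ≤ 64 * F.L ^ j → GaugeGroup.dist1 (GaugeField.plaqHol (Averaging.iter (fun i' => BlockAveraging.blockAvg (P := F.P K) (j := i') ℰp) i U) q) < θBal F.L γ b₀ p₀ (K - i))}ᶜ := by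
    refine (measureReal_mono (fun U hU => ?_) (measure_ne_top _ _)).trans (measureReal_union_le _ _)
    by_cases hG : U ∈ {U : GaugeField (F.P K) 0 (Matrix.specialUnitaryGroup (Fin 2) ℂ) | (∀ (i : ℕ) (q : Plaq (F.P K) i), i < j → Site.tdist (fun k => ((((q.src k).val * F.L ^ i : ℕ)) : ZMod ((F.P K).sitesPerDir 0))) (fun k => ((((a.src k).val * F.L ^ j : ℕ)) : ZMod ((F.P K).sitesPerDir 0))) + 64 * F.L ^ i ≤ 64 * F.L ^ j → GaugeGroup.dist1 (GaugeField.plaqHol (Averaging.iter (fun i' => BlockAveraging.blockAvg (P := F.P K) (j := i') ℰp) i U) q) < θBal F.L γ b₀ p₀ (K - i))}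
    · exact Or.inl ⟨hU, hG⟩
    · exact Or.inr hG
  -- the quantile and §2
  have hq := HQ F γ rfl hγ hγQ' K j hj hjK a
  have hint := integral_le_of_quantile (gibbsK F ℰp γ K) hmeas (fun U => GaugeGroup.dist1_nonneg _)
    (fun U => dist1_le_two_specialUnitaryGroup _) hθpos.le hq
  linarith [hint, hsplit, hGc, hbud, htail]

end Summit.QuantumFields.YangMills.Theorems.PoincareLipschitz.MedianCentring
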